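import Literature.NumberTheory.ModularSymbols.FullLevelHomologyTorusLevel
import Literature.NumberTheory.ModularSymbols.CuspidalHomologyHeckeModule
import Literature.Algebra.Homology.GroupHomologyDegreeOneTrivialLift
import HarnessLib

/-!
# From the full-level carrier to the cuspidal homology of `X₀(p²M)`:
# `H₁(Γ₀(N), R) ↠ H(N; R) = H₁(X₀(N), R)` by period symbols, and `H₁(Γ₀(M), k[GL₂(ℤ/p)])^{T̃} ↠ H(p²M; k)`

Topic `Literature/NumberTheory/ModularSymbols`; namespaces `Literature.NumberTheory.ModularSymbols` (the `Γ₀(N)`-level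
map) and `….FullLevel` (the composite with the up/down dictionary of `FullLevelHomologyTorusLevel`).  Definitions
with bodies + proved theorems; no named fact, no `sorry`, no instance, no notation.

* `symbolAddHom N R : Additive Γ₀(N) →+ H(N; R)`, `γ ↦ {∞, γ∞} ⊗ 1` (the tree's `symbol N R γ` of
  `CuspidalHomologyHeckeModule`; additive by Manin's relation `symbol_mul`).
* **`cuspidalClassMap N R : H₁(Γ₀(N), R) →ₗ[R] H(N; R)`**, `[γ ⊗ a] ↦ a · ({∞, γ∞} ⊗ 1)`
  (`H1Trivial.lift`), `cuspidalClassMap_single`, **`cuspidalClassMap_surjective`** (the symbols generate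
  `H(N; R)`, `span_range_symbol`).  Its kernel contains the classes of elliptic and parabolic elements
  (tree: `PeriodHomologyGroupPresentation`, `periodFunctional_eq_zero_of_isParabolic/_isElliptic`; equality of
  the kernel with `Γ_ep` modulo commutators is the tree's named fact
  `periodFunctional_ker_le_ellipticParabolic_sup_commutator`, Knapp Prop. 11.22) — not restated here.
* **`FullLevel.torusInvariantsToCuspidal k p M hpM : H₁(Γ₀(M), k[GL₂(ℤ/p)])^{T̃} →ₗ[k] H(p²M; k)`** =
  `cuspidalClassMap (p²M) k ∘ torusInvariantsEquivGamma0` and **`torusInvariantsToCuspidal_surjective`**: the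
  homology of `X₀(p²M)` with coefficients in `k` (the tree's Hecke module `H(p²M; k) = k ⊗ H₁(X₀(p²M), ℤ)`, on
  which the period maps `periodMap f` to the period lattices `Λ_f` are defined) is a QUOTIENT of the torus
  invariants of the full-level carrier — the up/down dictionary (S2) of the composed K-line of route
  BSD/TeichmullerTwistDescent (crux `TwistedPeriodLatticeSaturation`, stmt 25368) down to the level where the
  tree's modular symbols, Hecke operators (`hecke`, `heckeOp`) and period lattices live.

Hypotheses `[Fintype T̃] [Invertible (|T̃| : k)]` as in `FullLevelHomologyTorusLevel` (`|T̃| = (p−1)²`).  Nothing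
about any elliptic curve is asserted.

## References
* A. W. Knapp, *Elliptic Curves* (1993), Prop. 11.22 (`H₁(X₀(N), ℤ) ≅ Γ₀(N)ᵃᵇ/Γ_epᵃᵇ`), (11.36)–(11.37). [Knapp1993]
* J. E. Cremona, *Algorithms for modular elliptic curves* (1997), §2.1 Lemma 2.1.1. [CremonaAlgorithms1997]
* Ju. I. Manin, *Parabolic points and zeta functions of modular curves* (1972), Prop. 1.4. [Manin1972]
* A. Ash, G. Stevens, Duke Math. J. 53 (1986), §1 (1.2)–(1.3). [AshStevens1986]
-/

noncomputable section

namespace Literature.NumberTheory.ModularSymbols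

open scoped MatrixGroups
open CategoryTheory CongruenceSubgroup groupHomology Finsupp Matrix
open Literature.Algebra.Homology

section CuspidalClass

variable (N : ℕ) [NeZero N] (R : Type) [CommRing R]

/-- The modular symbol `γ ↦ {∞, γ∞} ⊗ 1 ∈ H(N; R)` as an additive map on `Γ₀(N)` (Manin's relation
`{∞, γδ∞} = {∞, γ∞} + {∞, δ∞}`). [cite: Manin1972, Prop. 1.4] -/
def symbolAddHom : Additive (Gamma0 N) →+ CuspidalHomologyHeckeModule N R where
  toFun γ := symbol N R (Additive.toMul γ)
  map_zero' := symbol_one N R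
  map_add' _ _ := symbol_mul N R _ _

/-- Unfolding `symbolAddHom`. [cite: Manin1972, Prop. 1.4] -/
theorem symbolAddHom_apply (γ : Gamma0 N) : symbolAddHom N R (Additive.ofMul γ) = symbol N R γ := rfl

/-- **`H₁(Γ₀(N), R) → H₁(X₀(N), R) = H(N; R)`**, `[γ ⊗ a] ↦ a · ({∞, γ∞} ⊗ 1)`: the map induced on group homology
by the period symbols (Knapp Prop. 11.22: `H₁(X₀(N), ℤ) ≅ Γ₀(N)ᵃᵇ/Γ_epᵃᵇ`; `H₁(Γ₀(N), R) = Γ₀(N)ᵃᵇ ⊗ R`).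
[cite: Knapp1993, Prop. 11.22 (PDF p. 242)] -/
def cuspidalClassMap : groupHomology.H1 (Rep.trivial R (Gamma0 N) R) →ₗ[R] CuspidalHomologyHeckeModule N R :=
  H1Trivial.lift R (symbolAddHom N R)

/-- `cuspidalClassMap [γ ⊗ a] = a · ({∞, γ∞} ⊗ 1)`. [cite: Knapp1993, Prop. 11.22] -/
theorem cuspidalClassMap_single (γ : Gamma0 N) (a : R) :
    cuspidalClassMap N R (H1π _ ((cycles₁IsoOfIsTrivial (Rep.trivial R (Gamma0 N) R)).inv (single γ a))) =
      a • symbol N R γ :=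
  H1Trivial.lift_single R (symbolAddHom N R) γ a

/-- `H₁(Γ₀(N), R) → H(N; R)` is onto (the symbols `{∞, γ∞} ⊗ 1` generate `H(N; R)`; Cremona Lemma 2.1.1).
[cite: CremonaAlgorithms1997, §2.1 Lemma 2.1.1] -/
theorem cuspidalClassMap_surjective : Function.Surjective (cuspidalClassMap N R) := by
  rw [← LinearMap.range_eq_top, cuspidalClassMap, H1Trivial.range_lift]
  have h : Set.range (symbolAddHom N R) = Set.range (symbol N R) := by
    ext w
    constructor
    · rintro ⟨γ, rfl⟩; exact ⟨Additive.toMul γ, rfl⟩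
    · rintro ⟨γ, rfl⟩; exact ⟨Additive.ofMul γ, rfl⟩
  rw [h, span_range_symbol]

end CuspidalClass

namespace FullLevel

variable (k : Type) [CommRing k] (p M : ℕ) [Fact p.Prime] [NeZero M]

/-- `NeZero (p² M)` for `p` prime, `M ≠ 0` (plumbing). [cite: DiamondShurman2005, §1.2] -/
theorem neZero_sq_mul : NeZero (p ^ 2 * M) :=
  ⟨mul_ne_zero (pow_ne_zero 2 (Fact.out : p.Prime).ne_zero) (NeZero.ne M)⟩

/-- **From the full-level carrier to the cuspidal homology of `X₀(p²M)`**: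
`H₁(Γ₀(M), k[GL₂(ℤ/p)])^{T̃} ≃ H₁(Γ₀(p²M), k) ↠ H(p²M; k) = H₁(X₀(p²M), k)` (the up/down dictionary (S2)
followed by the period symbols; `gcd(p, M) = 1`, `|T̃| ∈ kˣ`). [cite: AshStevens1986, §1 (1.2)–(1.3); Knapp1993, Prop. 11.22] -/
def torusInvariantsToCuspidal (hpM : Nat.Coprime p M) [Fintype (diagTorus (ZMod p))]
    [Invertible (Fintype.card (diagTorus (ZMod p)) : k)] :
    PermutationCoeff.H1Invariants k (redGL p M) (diagTorus (ZMod p)) →ₗ[k]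
      @CuspidalHomologyHeckeModule (p ^ 2 * M) (neZero_sq_mul p M) k _ :=
  (@cuspidalClassMap (p ^ 2 * M) (neZero_sq_mul p M) k _).comp
    (torusInvariantsEquivGamma0 k p M hpM).toLinearMap

/-- The map `H₁(Γ₀(M), k[GL₂(ℤ/p)])^{T̃} → H(p²M; k)` is onto. [cite: AshStevens1986, §1 (1.3); CremonaAlgorithms1997, §2.1 Lemma 2.1.1] -/
theorem torusInvariantsToCuspidal_surjective (hpM : Nat.Coprime p M) [Fintype (diagTorus (ZMod p))]
    [Invertible (Fintype.card (diagTorus (ZMod p)) : k)] :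
    Function.Surjective (torusInvariantsToCuspidal k p M hpM) :=
  (@cuspidalClassMap_surjective (p ^ 2 * M) (neZero_sq_mul p M) k _).comp
    (torusInvariantsEquivGamma0 k p M hpM).surjective

end FullLevel

end Literature.NumberTheory.ModularSymbols
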